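import Literature.AlgebraicTopology.KTheory.BottLinearAlg
import HarnessLib

/-!
# The block homotopies (3.3) and (3.4) of Husemöller, *Fibre Bundles*, Ch. 11 §3

Pure block-matrix algebra (continuing `BottLinearAlg.lean`) behind the well-definedness of the
index map of Bott periodicity (Husemöller 11 Props. 3.3, 3.4, 4.8): for polynomial coefficients
`a : Fin (m+1) → M_ι(S)`, `snocZero a` (the same polynomial viewed in degree `≤ m+1`) and
`consZero a` (the coefficients of `z p`), with `polyEval_snocZero`, `polyEval_consZero`;

* **(3.3)** `H33 a z t = [[Lᵐ(p), 0],[(0,…,0,-(1-t)z), 1]]` on `Fin (m+1) ⊕ Fin 1`: explicit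
  two-sided inverse `H33Inv` (given an inverse of `Lᵐ(p)`), `H33_one = Lᵐ(p) ⊕ 1`,
  `reindex_H33_zero : reindex (H33 a z 0) = Lᵐ⁺¹(snocZero a)`, linearity
  `H33_eq : H33 = H33A + z • H33B t` with `H33B_one` block diagonal;
* **(3.4)** `H34 a z t = [[-z, ((1-t),0,…,0)],[0, Lᵐ(p)]]` on `Fin 1 ⊕ Fin (m+1)`: explicit
  inverse `H34Inv` (given inverses of `z` and `Lᵐ(p)`), `H34_one = (-z) ⊕ Lᵐ(p)`,
  `reindex_H34_zero : reindex (H34 a z 0) = Lᵐ⁺¹(consZero a)` *with its first two block rows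
  swapped* (`submatrix (Equiv.swap 0 1) id`), linearity `H34_eq`, `H34A_one`;
* change of rings for all block families, and `Matrix.comp` of block matrices / permuted
  matrices (`comp_fromBlocks`, `comp_submatrix`).

Everything is proved; no named facts.

## References

* D. Husemöller, *Fibre Bundles*, 3rd ed. (1994) [HusemollerFibreBundles1994]: Ch. 11 Props.
  3.3, 3.4 (and their use in Prop. 4.8, Thm. 5.4).
-/

namespace Literature.AlgebraicTopology.KTheory.Linearization

open Matrix Finset

variable {S : Type*} [CommRing S] {ι : Type*} [Fintype ι] [DecidableEq ι] {m : ℕ}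

/-! ### Padding and shifting polynomial coefficients -/

/-- `p` viewed as a polynomial of degree `≤ m + 1` (`a_{m+1} = 0`). [cite: HusemollerFibreBundles1994, Ch. 11 Prop. 3.3] -/
def snocZero (a : Fin (m + 1) → Matrix ι ι S) : Fin (m + 2) → Matrix ι ι S := Fin.snoc a 0

/-- The coefficients of `z p` (`a'_0 = 0`, `a'_{k+1} = a_k`). [cite: HusemollerFibreBundles1994, Ch. 11 Prop. 3.4] -/
def consZero (a : Fin (m + 1) → Matrix ι ι S) : Fin (m + 2) → Matrix ι ι S := Fin.cons 0 a

omit [Fintype ι] [DecidableEq ι] in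
/-- Auxiliary statement for the (3.3)/(3.4) block homotopies. [folklore] -/
@[simp] theorem snocZero_castSucc (a : Fin (m + 1) → Matrix ι ι S) (i : Fin (m + 1)) : snocZero a i.castSucc = a i := Fin.snoc_castSucc ..
omit [Fintype ι] [DecidableEq ι] in
/-- Auxiliary statement for the (3.3)/(3.4) block homotopies. [folklore] -/
@[simp] theorem snocZero_last (a : Fin (m + 1) → Matrix ι ι S) : snocZero a (Fin.last (m + 1)) = 0 := Fin.snoc_last ..
omit [Fintype ι] [DecidableEq ι] in
/-- Auxiliary statement for the (3.3)/(3.4) block homotopies. [folklore] -/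
@[simp] theorem consZero_zero (a : Fin (m + 1) → Matrix ι ι S) : consZero a 0 = 0 := Fin.cons_zero ..
omit [Fintype ι] [DecidableEq ι] in
/-- Auxiliary statement for the (3.3)/(3.4) block homotopies. [folklore] -/
@[simp] theorem consZero_succ (a : Fin (m + 1) → Matrix ι ι S) (i : Fin (m + 1)) : consZero a i.succ = a i := Fin.cons_succ ..

omit [Fintype ι] [DecidableEq ι] in
/-- Auxiliary statement for the (3.3)/(3.4) block homotopies. [folklore] -/
theorem polyEval_snocZero (a : Fin (m + 1) → Matrix ι ι S) (z : S) : polyEval (snocZero a) z = polyEval a z := by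
  rw [polyEval, polyEval, Fin.sum_univ_castSucc, snocZero_last, smul_zero, add_zero]
  simp

omit [Fintype ι] [DecidableEq ι] in
/-- Auxiliary statement for the (3.3)/(3.4) block homotopies. [folklore] -/
theorem polyEval_consZero (a : Fin (m + 1) → Matrix ι ι S) (z : S) : polyEval (consZero a) z = z • polyEval a z := by
  rw [polyEval, polyEval, Fin.sum_univ_succ, consZero_zero, smul_zero, zero_add, Finset.smul_sum]
  simp only [Fin.val_succ, pow_succ, mul_smul, consZero_succ]
  exact Finset.sum_congr rfl fun i _ ↦ smul_comm _ _ _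

/-! ### (3.3): `Lᵐ⁺¹(p) ≃ Lᵐ(p) ⊕ 1` -/

/-- The last block row `(0, …, 0, -(1 - t) z)` of the (3.3) homotopy. [cite: HusemollerFibreBundles1994, Ch. 11 Prop. 3.3] -/
def lastRow (m : ℕ) (z t : S) : Matrix (Fin 1) (Fin (m + 1)) (Matrix ι ι S) :=
  Matrix.of fun _ c ↦ if c = Fin.last m then -(((1 - t) * z) • (1 : Matrix ι ι S)) else 0

/-- **The (3.3) homotopy** `H₃₃(t) = [[Lᵐ(p), 0], [(0,…,0,-(1-t)z), 1]]` on the index type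
`Fin (m+1) ⊕ Fin 1`. [cite: HusemollerFibreBundles1994, Ch. 11 Prop. 3.3] -/
def H33 (a : Fin (m + 1) → Matrix ι ι S) (z t : S) : Matrix (Fin (m + 1) ⊕ Fin 1) (Fin (m + 1) ⊕ Fin 1) (Matrix ι ι S) :=
  Matrix.fromBlocks (Lmat a z) 0 (lastRow m z t) 1

/-- The explicit inverse of `H₃₃(t)`. [folklore] -/
def H33Inv (z t : S) (LInv : Blk m ι S) : Matrix (Fin (m + 1) ⊕ Fin 1) (Fin (m + 1) ⊕ Fin 1) (Matrix ι ι S) :=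
  Matrix.fromBlocks LInv 0 (-(lastRow m z t * LInv)) 1

/-- Auxiliary statement for the (3.3)/(3.4) block homotopies. [folklore] -/
theorem H33_mul_H33Inv (a : Fin (m + 1) → Matrix ι ι S) (z t : S) {LInv : Blk m ι S} (h : Lmat a z * LInv = 1) :
    H33 a z t * H33Inv z t LInv = 1 := by
  rw [H33, H33Inv, Matrix.fromBlocks_multiply, ← Matrix.fromBlocks_one]
  simp [h, Matrix.mul_neg]

/-- Auxiliary statement for the (3.3)/(3.4) block homotopies. [folklore] -/
theorem H33Inv_mul_H33 (a : Fin (m + 1) → Matrix ι ι S) (z t : S) {LInv : Blk m ι S} (h : LInv * Lmat a z = 1) :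
    H33Inv z t LInv * H33 a z t = 1 := by
  rw [H33, H33Inv, Matrix.fromBlocks_multiply, ← Matrix.fromBlocks_one]
  simp [h, Matrix.neg_mul, Matrix.mul_assoc]

omit [Fintype ι] in
/-- At `t = 1` the (3.3) homotopy is block diagonal `Lᵐ(p) ⊕ 1`. [cite: HusemollerFibreBundles1994, Ch. 11 Prop. 3.3] -/
theorem H33_one (a : Fin (m + 1) → Matrix ι ι S) (z : S) : H33 a z 1 = Matrix.fromBlocks (Lmat a z) 0 0 1 := by
  rw [H33]; congr 1
  ext r c : 1
  simp [lastRow]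

omit [Fintype ι] in
/-- At `t = 0` the (3.3) homotopy is `Lᵐ⁺¹(p)` (re-indexed). [cite: HusemollerFibreBundles1994, Ch. 11 Prop. 3.3] -/
theorem reindex_H33_zero (a : Fin (m + 1) → Matrix ι ι S) (z : S) :
    Matrix.reindex finSumFinEquiv finSumFinEquiv (H33 a z 0) = Lmat (snocZero a) z := by
  ext r c : 1
  rw [Matrix.reindex_apply, Matrix.submatrix_apply]
  have hl : (finSumFinEquiv.symm (Fin.last (m + 1)) : Fin (m + 1) ⊕ Fin 1) = Sum.inr 0 := finSumFinEquiv_symm_last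
  have hc : ∀ i : Fin (m + 1), (finSumFinEquiv.symm i.castSucc : Fin (m + 1) ⊕ Fin 1) = Sum.inl i := fun i ↦
    finSumFinEquiv_symm_apply_castAdd i
  have hlast0 : (Fin.last (m + 1) : Fin (m + 2)) ≠ 0 := by simp [Fin.ext_iff]
  induction r using Fin.lastCases with
  | last =>
    induction c using Fin.lastCases with
    | last => rw [hl, H33, Matrix.fromBlocks_apply₂₂, Lmat, Matrix.of_apply, if_neg hlast0, if_pos rfl, Matrix.one_apply_eq]
    | cast c =>
      rw [hl, hc, H33, Matrix.fromBlocks_apply₂₁, Lmat, Matrix.of_apply, lastRow, Matrix.of_apply, if_neg hlast0,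
        if_neg (Fin.castSucc_lt_last c).ne]
      by_cases h : c = Fin.last m
      · subst h
        rw [if_pos rfl, if_pos (by simp [Fin.val_last]), sub_zero, one_mul]
      · rw [if_neg h, if_neg]
        intro h'; apply h; ext; simp [Fin.val_last] at h' ⊢; omega
  | cast r =>
    induction c using Fin.lastCases with
    | last =>
      rw [hl, hc, H33, Matrix.fromBlocks_apply₁₂, Matrix.zero_apply, Lmat, Matrix.of_apply]
      by_cases hr : r.castSucc = 0
      · rw [if_pos hr, snocZero_last]
      · rw [if_neg hr, if_neg (Fin.castSucc_lt_last r).ne', if_neg]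
        intro h'; have := r.2; simp [Fin.val_last] at h'; omega
    | cast c =>
      rw [hc, hc, H33, Matrix.fromBlocks_apply₁₁, Lmat, Lmat, Matrix.of_apply, Matrix.of_apply, snocZero_castSucc]
      simp only [Fin.castSucc_inj, Fin.castSucc_eq_zero_iff, Fin.val_castSucc]
      rfl

/-- The `z`-free last row `(0, …, 0, -(1-t))`. [cite: HusemollerFibreBundles1994, Ch. 11 Prop. 3.3] -/
def lastRowB (m : ℕ) (t : S) : Matrix (Fin 1) (Fin (m + 1)) (Matrix ι ι S) :=
  Matrix.of fun _ c ↦ if c = Fin.last m then -((1 - t) • (1 : Matrix ι ι S)) else 0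

/-- The constant part of `H₃₃`: `LmatA(p) ⊕ 1`. [cite: HusemollerFibreBundles1994, Ch. 11 Prop. 3.3] -/
def H33A (a : Fin (m + 1) → Matrix ι ι S) : Matrix (Fin (m + 1) ⊕ Fin 1) (Fin (m + 1) ⊕ Fin 1) (Matrix ι ι S) :=
  Matrix.fromBlocks (LmatA a) 0 0 1

/-- The `z`-part of `H₃₃(t)`. [cite: HusemollerFibreBundles1994, Ch. 11 Prop. 3.3] -/
def H33B (m : ℕ) (t : S) : Matrix (Fin (m + 1) ⊕ Fin 1) (Fin (m + 1) ⊕ Fin 1) (Matrix ι ι S) :=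
  Matrix.fromBlocks (LmatB m ι S) 0 (lastRowB m t) 0

omit [Fintype ι] in
/-- `H₃₃(t) = H33A + z · H33B(t)` is linear in `z`. [cite: HusemollerFibreBundles1994, Ch. 11 Prop. 3.3] -/
theorem H33_eq (a : Fin (m + 1) → Matrix ι ι S) (z t : S) : H33 a z t = H33A a + z • H33B m t := by
  rw [H33, H33A, H33B, Matrix.fromBlocks_smul, Matrix.fromBlocks_add, Lmat_eq]
  congr 1 <;> try simp
  ext r c : 1
  simp only [lastRow, lastRowB, Matrix.of_apply, Matrix.smul_apply]
  split_ifs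
  · rw [smul_neg, smul_smul, mul_comm]
  · rw [smul_zero]

omit [Fintype ι] in
/-- Auxiliary statement for the (3.3)/(3.4) block homotopies. [folklore] -/
theorem H33B_one : (H33B m 1 : Matrix _ _ (Matrix ι ι S)) = Matrix.fromBlocks (LmatB m ι S) 0 0 0 := by
  rw [H33B]; congr 1; ext r c : 1; simp [lastRowB]

/-! ### (3.4): `Lᵐ⁺¹(zp) ≃ (-z) ⊕ Lᵐ(p)` up to a row swap -/

/-- The top block row `((1-t), 0, …, 0)` of the (3.4) homotopy. [cite: HusemollerFibreBundles1994, Ch. 11 Prop. 3.4] -/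
def topRow (m : ℕ) (t : S) : Matrix (Fin 1) (Fin (m + 1)) (Matrix ι ι S) :=
  Matrix.of fun _ c ↦ if c = 0 then (1 - t) • (1 : Matrix ι ι S) else 0

/-- **The (3.4) homotopy** (rows `0,1` swapped): `H₃₄(t) = [[-z, ((1-t),0,…,0)],[0, Lᵐ(p)]]` on
`Fin 1 ⊕ Fin (m+1)`. [cite: HusemollerFibreBundles1994, Ch. 11 Prop. 3.4] -/
def H34 (a : Fin (m + 1) → Matrix ι ι S) (z t : S) : Matrix (Fin 1 ⊕ Fin (m + 1)) (Fin 1 ⊕ Fin (m + 1)) (Matrix ι ι S) :=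
  Matrix.fromBlocks (-(z • (1 : Matrix (Fin 1) (Fin 1) (Matrix ι ι S)))) (topRow m t) 0 (Lmat a z)

/-- The explicit inverse of `H₃₄(t)`. [folklore] -/
def H34Inv (t zinv : S) (LInv : Blk m ι S) : Matrix (Fin 1 ⊕ Fin (m + 1)) (Fin 1 ⊕ Fin (m + 1)) (Matrix ι ι S) :=
  Matrix.fromBlocks (-(zinv • (1 : Matrix (Fin 1) (Fin 1) (Matrix ι ι S)))) (zinv • (topRow m t * LInv)) 0 LInv

/-- Auxiliary statement for the (3.3)/(3.4) block homotopies. [folklore] -/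
theorem H34_mul_H34Inv (a : Fin (m + 1) → Matrix ι ι S) {z t zinv : S} (hz : z * zinv = 1) {LInv : Blk m ι S}
    (h : Lmat a z * LInv = 1) : H34 a z t * H34Inv t zinv LInv = 1 := by
  rw [H34, H34Inv, Matrix.fromBlocks_multiply, ← Matrix.fromBlocks_one]
  congr 1
  · rw [Matrix.neg_mul, Matrix.mul_neg, neg_neg, Matrix.smul_mul, Matrix.mul_smul, Matrix.one_mul, smul_smul, hz, one_smul, Matrix.mul_zero,
      add_zero]
  · rw [Matrix.neg_mul, Matrix.smul_mul, Matrix.one_mul, smul_smul, hz, one_smul, neg_add_cancel]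
  · rw [Matrix.zero_mul, zero_add, Matrix.mul_zero]
  · rw [Matrix.zero_mul, zero_add, h]

/-- Auxiliary statement for the (3.3)/(3.4) block homotopies. [folklore] -/
theorem H34Inv_mul_H34 (a : Fin (m + 1) → Matrix ι ι S) {z t zinv : S} (hz : zinv * z = 1) {LInv : Blk m ι S}
    (h : LInv * Lmat a z = 1) : H34Inv t zinv LInv * H34 a z t = 1 := by
  rw [H34, H34Inv, Matrix.fromBlocks_multiply, ← Matrix.fromBlocks_one]
  congr 1
  · rw [Matrix.neg_mul, Matrix.mul_neg, neg_neg, Matrix.smul_mul, Matrix.mul_smul, Matrix.one_mul, smul_smul, hz, one_smul, Matrix.mul_zero,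
      add_zero]
  · rw [Matrix.neg_mul, Matrix.smul_mul, Matrix.one_mul, Matrix.smul_mul, Matrix.mul_assoc, h, Matrix.mul_one, neg_add_cancel]
  · rw [Matrix.zero_mul, zero_add, Matrix.mul_zero]
  · rw [Matrix.zero_mul, zero_add, h]

omit [Fintype ι] in
/-- At `t = 1` the (3.4) homotopy is block diagonal `(-z) ⊕ Lᵐ(p)`. [cite: HusemollerFibreBundles1994, Ch. 11 Prop. 3.4] -/
theorem H34_one (a : Fin (m + 1) → Matrix ι ι S) (z : S) :
    H34 a z 1 = Matrix.fromBlocks (-(z • (1 : Matrix (Fin 1) (Fin 1) (Matrix ι ι S)))) 0 0 (Lmat a z) := by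
  rw [H34]; congr 1; ext r c : 1; simp [topRow]

/-- The constant part of `H₃₄(t)`. [cite: HusemollerFibreBundles1994, Ch. 11 Prop. 3.4] -/
def H34A (a : Fin (m + 1) → Matrix ι ι S) (t : S) : Matrix (Fin 1 ⊕ Fin (m + 1)) (Fin 1 ⊕ Fin (m + 1)) (Matrix ι ι S) :=
  Matrix.fromBlocks 0 (topRow m t) 0 (LmatA a)

/-- The `z`-part of `H₃₄`: `(-1) ⊕ LmatB`. [cite: HusemollerFibreBundles1994, Ch. 11 Prop. 3.4] -/
def H34B (m : ℕ) : Matrix (Fin 1 ⊕ Fin (m + 1)) (Fin 1 ⊕ Fin (m + 1)) (Matrix ι ι S) :=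
  Matrix.fromBlocks (-1) 0 0 (LmatB m ι S)

omit [Fintype ι] in
/-- `H₃₄(t) = H34A(t) + z · H34B`. [cite: HusemollerFibreBundles1994, Ch. 11 Prop. 3.4] -/
theorem H34_eq (a : Fin (m + 1) → Matrix ι ι S) (z t : S) : H34 a z t = H34A a t + z • H34B m := by
  rw [H34, H34A, H34B, Matrix.fromBlocks_smul, Matrix.fromBlocks_add, Lmat_eq]
  congr 1 <;> simp

omit [Fintype ι] in
/-- Auxiliary statement for the (3.3)/(3.4) block homotopies. [folklore] -/
theorem H34A_one (a : Fin (m + 1) → Matrix ι ι S) : H34A a 1 = Matrix.fromBlocks 0 0 0 (LmatA a) := by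
  rw [H34A]; congr 1; ext r c : 1; simp [topRow]

/-- The index equivalence `Fin 1 ⊕ Fin (m+1) ≃ Fin (m+2)`: `inl ↦ 0`, `inr i ↦ i + 1`. [folklore] -/
def e34 (m : ℕ) : Fin 1 ⊕ Fin (m + 1) ≃ Fin (m + 2) where
  toFun := Sum.elim (fun _ ↦ 0) Fin.succ
  invFun r := Fin.cases (Sum.inl 0) (fun r' ↦ Sum.inr r') r
  left_inv s := by
    rcases s with i | i
    · simp only [Sum.elim_inl, Fin.cases_zero]; congr 1; exact Subsingleton.elim _ _
    · simp only [Sum.elim_inr, Fin.cases_succ]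
  right_inv r := by
    induction r using Fin.cases <;> simp

/-- Auxiliary statement for the (3.3)/(3.4) block homotopies. [folklore] -/
@[simp] theorem e34_symm_zero : (e34 m).symm 0 = Sum.inl 0 := rfl
/-- Auxiliary statement for the (3.3)/(3.4) block homotopies. [folklore] -/
@[simp] theorem e34_symm_succ (i : Fin (m + 1)) : (e34 m).symm i.succ = Sum.inr i := by
  change (Fin.cases (Sum.inl 0) (fun r' ↦ Sum.inr r') i.succ : Fin 1 ⊕ Fin (m + 1)) = _
  rw [Fin.cases_succ]

omit [Fintype ι] in
/-- **At `t = 0` the (3.4) homotopy is `Lᵐ⁺¹(z p)` with its first two block rows swapped.**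
[cite: HusemollerFibreBundles1994, Ch. 11 Prop. 3.4] -/
theorem reindex_H34_zero (a : Fin (m + 1) → Matrix ι ι S) (z : S) :
    Matrix.reindex (e34 m) (e34 m) (H34 a z 0) = (Lmat (consZero a) z).submatrix (Equiv.swap 0 1) id := by
  ext r c : 1
  rw [Matrix.reindex_apply, Matrix.submatrix_apply, Matrix.submatrix_apply, id]
  have h10 : (1 : Fin (m + 2)) = (0 : Fin (m + 1)).succ := rfl
  induction r using Fin.cases with
  | zero =>
    rw [e34_symm_zero, Equiv.swap_apply_left, h10]
    induction c using Fin.cases with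
    | zero =>
      rw [e34_symm_zero, H34, Matrix.fromBlocks_apply₁₁, Lmat, Matrix.of_apply, if_neg (Fin.succ_ne_zero _), if_neg (Fin.succ_ne_zero _).symm,
        if_pos (by simp)]
      simp
    | succ c =>
      rw [e34_symm_succ, H34, Matrix.fromBlocks_apply₁₂, topRow, Matrix.of_apply, Lmat, Matrix.of_apply, if_neg (Fin.succ_ne_zero _),
        sub_zero, one_smul]
      simp only [Fin.succ_inj]
      by_cases hc : c = 0
      · rw [if_pos hc, if_pos hc]
      · rw [if_neg hc, if_neg hc, if_neg]
        simp [Fin.val_succ]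
  | succ r =>
    rw [e34_symm_succ]
    induction c using Fin.cases with
    | zero =>
      rw [e34_symm_zero, H34, Matrix.fromBlocks_apply₂₁, Matrix.zero_apply, Lmat, Matrix.of_apply]
      by_cases hr : r = 0
      · subst hr
        rw [← h10, Equiv.swap_apply_right, if_pos rfl, consZero_zero]
      · rw [Equiv.swap_apply_of_ne_of_ne (Fin.succ_ne_zero _) (by rwa [h10, Ne, Fin.succ_inj]), if_neg (Fin.succ_ne_zero _),
          if_neg (Fin.succ_ne_zero _).symm, if_neg]
        simp only [Fin.val_zero, zero_add, Fin.val_succ]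
        intro h; apply hr; ext; simp at h; omega
    | succ c =>
      rw [e34_symm_succ, H34, Matrix.fromBlocks_apply₂₂, Lmat, Lmat, Matrix.of_apply, Matrix.of_apply]
      by_cases hr : r = 0
      · subst hr
        rw [← h10, Equiv.swap_apply_right, if_pos rfl, if_pos rfl, consZero_succ]
      · rw [Equiv.swap_apply_of_ne_of_ne (Fin.succ_ne_zero _) (by rwa [h10, Ne, Fin.succ_inj]), if_neg hr, if_neg (Fin.succ_ne_zero _)]
        simp only [Fin.succ_inj, Fin.val_succ, add_left_inj]

/-! ### Inverses of `Lᵐ(p)`, change of rings, and `Matrix.comp` of block matrices -/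

/-- `Lᵐ(p) · (LtInv at t = 1) = 1`. [cite: HusemollerFibreBundles1994, Ch. 11 Notation 3.1] -/
theorem Lmat_mul_LtInv (a : Fin (m + 1) → Matrix ι ι S) (z : S) {pinv : Matrix ι ι S} (h : polyEval a z * pinv = 1) :
    Lmat a z * LtInv a z 1 pinv = 1 := by rw [← Lt_one]; exact Lt_mul_LtInv a z 1 h

/-- `(LtInv at t = 1) · Lᵐ(p) = 1`. [cite: HusemollerFibreBundles1994, Ch. 11 Notation 3.1] -/
theorem LtInv_mul_Lmat (a : Fin (m + 1) → Matrix ι ι S) (z : S) {pinv : Matrix ι ι S} (h : pinv * polyEval a z = 1) :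
    LtInv a z 1 pinv * Lmat a z = 1 := by rw [← Lt_one]; exact LtInv_mul_Lt a z 1 h

variable {S' : Type*} [CommRing S']

/-- Auxiliary statement for the (3.3)/(3.4) block homotopies. [folklore] -/
theorem LmatA_map (a : Fin (m + 1) → Matrix ι ι S) (f : S →+* S') :
    (LmatA a).map f.mapMatrix = LmatA (fun k ↦ (a k).map f) := by
  ext r c : 1
  simp only [LmatA, Matrix.map_apply, Matrix.of_apply]
  split_ifs
  · rfl
  · exact Matrix.map_one _ (map_zero f) (map_one f)
  · exact Matrix.map_zero _ (map_zero f)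

/-- Auxiliary statement for the (3.3)/(3.4) block homotopies. [folklore] -/
theorem LmatB_map' (f : S →+* S') : (LmatB m ι S).map f.mapMatrix = LmatB m ι S' := by
  ext r c : 1
  simp only [LmatB, Matrix.map_apply, Matrix.of_apply]
  split_ifs
  · rw [RingHom.mapMatrix_apply, Matrix.map_neg _ (map_neg f), Matrix.map_one _ (map_zero f) (map_one f)]
  · exact Matrix.map_zero _ (map_zero f)

/-- Auxiliary statement for the (3.3)/(3.4) block homotopies. [folklore] -/
theorem topRow_map (t : S) (f : S →+* S') : (topRow m t : Matrix _ _ (Matrix ι ι S)).map f.mapMatrix = topRow m (f t) := by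
  ext r c : 1
  simp only [topRow, Matrix.map_apply, Matrix.of_apply]
  split_ifs
  · rw [RingHom.mapMatrix_apply, Matrix.map_smul' _ _ _ (map_mul f), map_sub, map_one, Matrix.map_one _ (map_zero f) (map_one f)]
  · exact Matrix.map_zero _ (map_zero f)

/-- Auxiliary statement for the (3.3)/(3.4) block homotopies. [folklore] -/
theorem lastRowB_map (t : S) (f : S →+* S') : (lastRowB m t : Matrix _ _ (Matrix ι ι S)).map f.mapMatrix = lastRowB m (f t) := by
  ext r c : 1
  simp only [lastRowB, Matrix.map_apply, Matrix.of_apply]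
  split_ifs
  · rw [RingHom.mapMatrix_apply, Matrix.map_neg _ (map_neg f), Matrix.map_smul' _ _ _ (map_mul f), map_sub, map_one,
      Matrix.map_one _ (map_zero f) (map_one f)]
  · exact Matrix.map_zero _ (map_zero f)

/-- Auxiliary statement for the (3.3)/(3.4) block homotopies. [folklore] -/
theorem H33A_map (a : Fin (m + 1) → Matrix ι ι S) (f : S →+* S') : (H33A a).map f.mapMatrix = H33A (fun k ↦ (a k).map f) := by
  rw [H33A, H33A, Matrix.fromBlocks_map, LmatA_map, Matrix.map_zero _ (map_zero _), Matrix.map_zero _ (map_zero _),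
    Matrix.map_one _ (map_zero _) (map_one _)]

/-- Auxiliary statement for the (3.3)/(3.4) block homotopies. [folklore] -/
theorem H33B_map (t : S) (f : S →+* S') : (H33B m t : Matrix _ _ (Matrix ι ι S)).map f.mapMatrix = H33B m (f t) := by
  rw [H33B, H33B, Matrix.fromBlocks_map, LmatB_map', lastRowB_map, Matrix.map_zero _ (map_zero _), Matrix.map_zero _ (map_zero _)]

/-- Auxiliary statement for the (3.3)/(3.4) block homotopies. [folklore] -/
theorem H34A_map (a : Fin (m + 1) → Matrix ι ι S) (t : S) (f : S →+* S') :
    (H34A a t).map f.mapMatrix = H34A (fun k ↦ (a k).map f) (f t) := by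
  rw [H34A, H34A, Matrix.fromBlocks_map, LmatA_map, topRow_map, Matrix.map_zero _ (map_zero _), Matrix.map_zero _ (map_zero _)]

/-- Auxiliary statement for the (3.3)/(3.4) block homotopies. [folklore] -/
theorem H34B_map (f : S →+* S') : (H34B m : Matrix _ _ (Matrix ι ι S)).map f.mapMatrix = H34B m := by
  rw [H34B, H34B, Matrix.fromBlocks_map, LmatB_map', Matrix.map_zero _ (map_zero _), Matrix.map_zero _ (map_zero _),
    Matrix.map_neg _ (map_neg _), Matrix.map_one _ (map_zero _) (map_one _)]

omit [Fintype ι] [DecidableEq ι] [CommRing S] in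
/-- `Matrix.comp` of a block matrix is the block matrix of the `comp`s, up to distributing the
index product. [folklore] -/
theorem comp_fromBlocks [CommRing S] {α β : Type*} (A : Matrix α α (Matrix ι ι S)) (B : Matrix α β (Matrix ι ι S))
    (C : Matrix β α (Matrix ι ι S)) (D : Matrix β β (Matrix ι ι S)) :
    Matrix.comp _ _ _ _ _ (Matrix.fromBlocks A B C D) =
      Matrix.reindex (Equiv.sumProdDistrib α β ι).symm (Equiv.sumProdDistrib α β ι).symm
        (Matrix.fromBlocks (Matrix.comp _ _ _ _ _ A) (Matrix.comp _ _ _ _ _ B) (Matrix.comp _ _ _ _ _ C) (Matrix.comp _ _ _ _ _ D)) := by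
  ext ⟨i | i, k⟩ ⟨j | j, l⟩ <;> rfl

omit [Fintype ι] [DecidableEq ι] [CommRing S] in
/-- `Matrix.comp` of a row-permuted block matrix. [folklore] -/
theorem comp_submatrix [CommRing S] {α α' : Type*} (M : Matrix α α (Matrix ι ι S)) (σ : α' → α) (τ : α' → α) :
    Matrix.comp _ _ _ _ _ (M.submatrix σ τ) = (Matrix.comp _ _ _ _ _ M).submatrix (Prod.map σ id) (Prod.map τ id) := by
  ext ⟨i, k⟩ ⟨j, l⟩; rfl

end Literature.AlgebraicTopology.KTheory.Linearization
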